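import Literature.Probability.RandomPlanarGeometry.HexSAWBrickWallStripBridges
import Literature.Probability.RandomPlanarGeometry.HexSAWBridgeInsertion
import Literature.Probability.RandomPlanarGeometry.SAWPolygonsFromBridges
import HarnessLib

/-!
# Honeycomb polygons from bridges, I: half-plane pieces extracted from brick-wall bridges

Topic `Literature/Probability/RandomPlanarGeometry` (lane «pcv-sawmu», door «HEX-SAP» `μ_polygon(ℍ) = μ_ℍ`;
continues `HexSAWBrickWallWalks.lean` / `HexSAWBrickWallStripBridges.lean` / `HexSAWBridgeInsertion.lean` — the honeycomb lattice as the brick wall `brickWallGraph` (`ℤ²` minus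
the vertical bonds `{(x,y),(x,y+1)}`, `x + y` odd), `HexBW.saws n ⊆ Zd.saws 2 n`, `HexBW.bridges n`, the parity
twist `twistAt` — and the tree's planar Madras–Slade gadgets of `SAWPolygonsFromBridges.lean`: the re-rooting
`Zd.reroot M i ω` of a bridge at a time `i` maximising `φₓ(z) = x₀z₁ − x₁z₀`, `x = ω(M)`).

Source: N. Madras, G. Slade, *The Self-Avoiding Walk* (1993), §3.2, proof of **Theorem 3.2.4** (pp. 65–67):
"let `ω` and `υ` be bridges in `B[M,x]` … Let `i` … maximize … `ω(i) · v` … Define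
`ω̄ = (ω(i), …, ω(M), ω(1) + ω(M), …, ω(i) + ω(M))` … `ω̄` and `ῡ` are both self-avoiding walks (since `ω` and
`υ` were bridges)", there for `ℤ^d`; J. M. Hammersley, Proc. Cambridge Philos. Soc. 57 (1961) 516–523
(`μ_polygon = μ` on `ℤ^d`).  For the honeycomb lattice no printed proof of `μ_polygon = μ` has been located
(asserted in A. J. Guttmann (ed.), LNP 775 (2009), Ch. 1 p. 3 and used in Ch. 8 §8.4.1; Guttmann, arXiv:1212.3448
§2.2); this file and its sequels supply one in the brick-wall frame.

## What changes on the honeycomb lattice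

The printed re-rooting translates part of the bridge by `x = ω(M)` and normalises by `−ω(i)`.  On the brick
wall a translation by `t` is an automorphism iff `t₀ + t₁` is even; `x` has the parity of `M` and `ω(i)` the
parity of `i` (`HexBW.parity_apply`).  So for EVEN `M` the re-rooted walk `Zd.reroot M i ω` is a honeycomb walk
when `i` is even, and its image under `negY : (x,y) ↦ (x,−y)` is one when `i` is odd — in both cases
`twistAt (ω i) ∘ Zd.reroot M i ω` is a honeycomb walk from `0` (`piece`), ending at `y = x` or `y = negY x`
(`pend`), and lying in the half-plane `s · φ_y ≤ 0` with `s = +1` ("type L") or `s = −1` ("type U")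
(`psgn`; `φ_{negY x}(negY z) = −φₓ(z)`).  The sequel glues two pieces of the SAME class `(y, s)` into a polygon.
For that gluing the endpoint must have `y₁ ≠ 0` and `y₀ ≥ 4`; both are arranged beforehand by appending a
fixed 4-step tail to every bridge (sequel `HexSAWBrickWallBridgeTail.lean`).

## Contents (namespace `Literature.Probability.RandomPlanarGeometry.SAW.HexBW`, all PROVED)

* brick-wall arithmetic: `adj_add_iff_of_even` (even translations), `adj_rsub_iff_of_odd` (point reflections
  `z ↦ c − z`, `c` odd, are automorphisms), `phi_twistAt`, `twist_mem_zd_saws`;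
* `am`, `piece`, `pend`, `psgn` and, for `ω ∈ bridges M`, `M` even: `piece_mem` (`∈ HexBW.saws M`),
  `piece_apply_of_le_M`/`piece_apply_M`, `psgn_mul_phi_piece_nonpos`, `eq_of_piece_eq` (injective given the
  re-rooting time), `pend_apply_zero`, `abs_pend_apply_one`, `parity_pend`;
* (the tail `B_M ↪ B_{M+4}` making the endpoint generic is in the sequel `HexSAWBrickWallBridgeTail.lean`).
-/

noncomputable section

open Finset Function Literature.Probability.LatticeModels Literature.Probability.Percolation SimpleGraph

namespace Literature.Probability.RandomPlanarGeometry.SAW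

namespace HexBW

/-! ### More arithmetic of the brick wall -/

/-- A translation by a site of even parity is an automorphism of the brick wall. [cite: EntingJensen2009, §7.4.2, Fig. 7.10 (brickwork form of the honeycomb lattice)] -/
theorem adj_add_iff_of_even {t : Site 2} (ht : (t 0 + t 1) % 2 = 0) (x y : Site 2) :
    brickWallGraph.Adj (x + t) (y + t) ↔ brickWallGraph.Adj x y := by
  simp only [brickWallGraph_adj_coord, Pi.add_apply]
  omega

/-- **The point reflection `z ↦ c − z` through a site `c` of ODD parity is an automorphism of the brick
wall** (it exchanges the two vertex classes and turns "up" bonds into "down" bonds). [cite: EntingJensen2009, §7.4.2, Fig. 7.10 (brickwork form of the honeycomb lattice)] -/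
theorem adj_rsub_iff_of_odd {c : Site 2} (hc : (c 0 + c 1) % 2 = 1) (x y : Site 2) :
    brickWallGraph.Adj (c - x) (c - y) ↔ brickWallGraph.Adj x y := by
  simp only [brickWallGraph_adj_coord, Pi.sub_apply]
  omega

/-- The sign of the twist at `p`: `+1` if `p₀ + p₁` is even (the twist is the identity), `−1` if it is odd
(the twist is `negY`). [cite: EntingJensen2009, §7.4.2, Fig. 7.10 (brickwork form of the honeycomb lattice)] -/
def tsgn (p : Site 2) : ℤ := if (p 0 + p 1) % 2 = 0 then 1 else -1

/-- `tsgn p = 1 ∨ tsgn p = -1`. [cite: EntingJensen2009, §7.4.2, Fig. 7.10 (brickwork form of the honeycomb lattice)] -/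
theorem tsgn_eq_or (p : Site 2) : tsgn p = 1 ∨ tsgn p = -1 := by
  unfold tsgn
  split_ifs <;> simp

/-- `tsgn p * tsgn p = 1`. [cite: EntingJensen2009, §7.4.2, Fig. 7.10 (brickwork form of the honeycomb lattice)] -/
theorem tsgn_mul_self (p : Site 2) : tsgn p * tsgn p = 1 := by
  rcases tsgn_eq_or p with h | h <;> rw [h] <;> norm_num

/-- `φ_{negY x}(negY z) = −φₓ(z)`. [cite: EntingJensen2009, §7.4.2, Fig. 7.10 (brickwork form of the honeycomb lattice)] -/
theorem phi_negY (x z : Site 2) : Zd.phi (negY x) (negY z) = -Zd.phi x z := by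
  simp only [Zd.phi, negY_apply_zero, negY_apply_one]
  ring

/-- **The twist multiplies the separating functional by its sign**: `φ_{twist x}(twist z) = tsgn · φₓ(z)`.
[cite: MadrasSlade1993, §3.2 (proof of Theorem 3.2.4)] -/
theorem phi_twistAt (p x z : Site 2) : Zd.phi (twistAt p x) (twistAt p z) = tsgn p * Zd.phi x z := by
  unfold twistAt tsgn
  split_ifs
  · rw [one_mul]
  · rw [phi_negY, neg_one_mul]

/-- Twisting a `ℤ²` self-avoiding walk from `0` pointwise gives a `ℤ²` self-avoiding walk from `0`.
[cite: MadrasSlade1993, §1.1] -/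
theorem twist_mem_zd_saws {n : ℕ} (p : Site 2) {ξ : ℕ → Site 2} (h : ξ ∈ Zd.saws 2 n) :
    (fun k => twistAt p (ξ k)) ∈ Zd.saws 2 n := by
  obtain ⟨h0, hend, hadj, hinj⟩ := Zd.mem_saws.1 h
  rw [Zd.mem_saws]
  refine ⟨by simp only [h0, twistAt_zero], fun i hi => by simp only [hend i hi],
    fun i hi => (zd_adj_twistAt_iff p _ _).2 (hadj i hi), fun i hi j hj hij => ?_⟩
  exact hinj hi hj (twistAt_injective p hij)

/-! ### Half-plane pieces extracted from bridges -/

/-- `i`: the chosen time maximising `φₓ ∘ ω`, `x = ω(M)` (the tree's `Zd.argmaxPhi`).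
[cite: MadrasSlade1993, §3.2 (proof of Theorem 3.2.4)] -/
def am (M : ℕ) (ω : ℕ → Site 2) : ℕ := Zd.argmaxPhi (ω M) M ω

/-- **The piece of a bridge**: the re-rooted walk `ω̄ − ω̄(0)` of Madras–Slade, twisted at the root `ω(i)`
so that it is a honeycomb walk from `0` whatever the parity of `i`. [cite: MadrasSlade1993, §3.2 (proof of Theorem 3.2.4)] -/
def piece (M : ℕ) (ω : ℕ → Site 2) : ℕ → Site 2 :=
  fun k => twistAt (ω (am M ω)) (Zd.reroot M (am M ω) ω k)

/-- The endpoint of the piece: `x = ω(M)` or `negY x`. [cite: MadrasSlade1993, §3.2 (proof of Theorem 3.2.4)] -/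
def pend (M : ℕ) (ω : ℕ → Site 2) : Site 2 := twistAt (ω (am M ω)) (ω M)

/-- The type of the piece: `+1` (it lies in `φ_y ≤ 0`) or `−1` (it lies in `φ_y ≥ 0`).
[cite: MadrasSlade1993, §3.2 (proof of Theorem 3.2.4)] -/
def psgn (M : ℕ) (ω : ℕ → Site 2) : ℤ := tsgn (ω (am M ω))

variable {M : ℕ} {ω : ℕ → Site 2}

/-- `i ≤ M`. [cite: MadrasSlade1993, §3.2 (proof of Theorem 3.2.4)] -/
theorem am_le (M : ℕ) (ω : ℕ → Site 2) : am M ω ≤ M := (Zd.argmaxPhi_spec (ω M) M ω).1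

/-- `i` maximises `φₓ ∘ ω` on `[0, M]`. [cite: MadrasSlade1993, §3.2 (proof of Theorem 3.2.4)] -/
theorem phi_le_phi_am (M : ℕ) (ω : ℕ → Site 2) {k : ℕ} (hk : k ≤ M) :
    Zd.phi (ω M) (ω k) ≤ Zd.phi (ω M) (ω (am M ω)) :=
  (Zd.argmaxPhi_spec (ω M) M ω).2 k hk

/-- `psgn = 1 ∨ psgn = -1`. [cite: MadrasSlade1993, §3.2 (proof of Theorem 3.2.4)] -/
theorem psgn_eq_or (M : ℕ) (ω : ℕ → Site 2) : psgn M ω = 1 ∨ psgn M ω = -1 := tsgn_eq_or _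

/-- **The steps of `ω̄` are brick-wall bonds** when `ω` is a honeycomb walk from `0` whose endpoint `x = ω(M)`
has even parity: they are steps of `ω`, or steps of `ω` translated by `x`. [cite: MadrasSlade1993, §3.2 (proof of Theorem 3.2.4)] -/
theorem adj_rerootRaw {i : ℕ} (hbw : IsBW M ω) (h0 : ω 0 = 0) (hx : (ω M 0 + ω M 1) % 2 = 0) (hi : i ≤ M)
    {k : ℕ} (hk : k < M) :
    brickWallGraph.Adj (Zd.rerootRaw M i ω k) (Zd.rerootRaw M i ω (k + 1)) := by
  by_cases h1 : i + (k + 1) ≤ M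
  · rw [Zd.rerootRaw_of_le (by omega), Zd.rerootRaw_of_le h1, ← add_assoc]
    exact hbw (i + k) (by omega)
  · by_cases h2 : i + k ≤ M
    · have hk' : i + k = M := by omega
      rw [Zd.rerootRaw_of_le h2, Zd.rerootRaw_of_lt (by omega), hk',
        show i + (k + 1) - M = 0 + 1 by omega]
      have := (adj_add_iff_of_even hx (ω 0) (ω (0 + 1))).2 (hbw 0 (by omega))
      rwa [h0, zero_add] at this
    · rw [Zd.rerootRaw_of_lt (by omega), Zd.rerootRaw_of_lt (by omega),
        show i + (k + 1) - M = (i + k - M) + 1 by omega, adj_add_iff_of_even hx]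
      exact hbw (i + k - M) (by omega)

/-- **The piece is a honeycomb walk**: all its steps are brick-wall bonds (the twist at the root `ω(i)`
composed with the translation by `−ω(i)` is an automorphism, `adj_twistAt_sub_iff`).
[cite: MadrasSlade1993, §3.2 (proof of Theorem 3.2.4)] -/
theorem isBW_piece (hω : ω ∈ saws M) (hM : M % 2 = 0) : IsBW M (piece M ω) := by
  obtain ⟨h0, -, hbw, -⟩ := mem_saws_iff.1 hω
  have hx : (ω M 0 + ω M 1) % 2 = 0 := by
    rw [parity_apply hω le_rfl]
    exact_mod_cast hM
  intro k hk
  simp only [piece]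
  rw [Zd.reroot_of_le hk.le, Zd.reroot_of_le (Nat.succ_le_of_lt hk), adj_twistAt_sub_iff]
  exact adj_rerootRaw hbw h0 hx (am_le M ω) hk

/-- The piece is an `M`-step `ℤ²` self-avoiding walk from `0` (the tree's `Zd.reroot_mem_saws`, twisted).
[cite: MadrasSlade1993, §3.2 (proof of Theorem 3.2.4)] -/
theorem piece_mem_zd (hω : ω ∈ bridges M) : piece M ω ∈ Zd.saws 2 M :=
  twist_mem_zd_saws _ (Zd.reroot_mem_saws (bridges_subset_zd M hω) (am_le M ω))

/-- **The piece of a honeycomb bridge of even length is a honeycomb self-avoiding walk from `0`.**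
[cite: MadrasSlade1993, §3.2 (proof of Theorem 3.2.4)] -/
theorem piece_mem (hω : ω ∈ bridges M) (hM : M % 2 = 0) : piece M ω ∈ saws M :=
  mem_saws.2 ⟨piece_mem_zd hω, isBW_piece (mem_bridges.1 hω).1 hM⟩

/-- From time `M` on, the piece sits at its endpoint `pend`. [cite: MadrasSlade1993, §3.2 (proof of Theorem 3.2.4)] -/
theorem piece_apply_of_M_le (hω : ω ∈ bridges M) {k : ℕ} (hk : M ≤ k) : piece M ω k = pend M ω := by
  have h0 : ω 0 = 0 := (Zd.mem_saws.1 (Zd.mem_bridges.1 (bridges_subset_zd M hω)).1).1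
  simp only [piece, pend, Zd.reroot_of_ge h0 (am_le M ω) hk]

/-- The piece ends at `pend`. [cite: MadrasSlade1993, §3.2 (proof of Theorem 3.2.4)] -/
theorem piece_apply_M (hω : ω ∈ bridges M) : piece M ω M = pend M ω := piece_apply_of_M_le hω le_rfl

/-- **The piece lies in the half-plane `psgn · φ_y ≤ 0`**, `y = pend` ("`ω̄(0) · v = ω̄(M) · v ≥ ω̄(k) · v`",
twisted). [cite: MadrasSlade1993, §3.2 (proof of Theorem 3.2.4)] -/
theorem psgn_mul_phi_piece_nonpos (M : ℕ) (ω : ℕ → Site 2) {k : ℕ} (hk : k ≤ M) :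
    psgn M ω * Zd.phi (pend M ω) (piece M ω k) ≤ 0 := by
  simp only [piece, pend, psgn, phi_twistAt, ← mul_assoc, tsgn_mul_self, one_mul]
  exact Zd.phi_reroot_nonpos (am_le M ω) (fun j hj => phi_le_phi_am M ω hj) k hk

/-- The height of the endpoint of the piece is that of the bridge. [cite: MadrasSlade1993, §3.2 (proof of Theorem 3.2.4)] -/
theorem pend_apply_zero (M : ℕ) (ω : ℕ → Site 2) : pend M ω 0 = ω M 0 := twistAt_apply_zero _ _

/-- The second coordinate of the endpoint of the piece is that of the bridge up to sign. [cite: MadrasSlade1993, §3.2 (proof of Theorem 3.2.4)] -/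
theorem abs_pend_apply_one (M : ℕ) (ω : ℕ → Site 2) : |pend M ω 1| = |ω M 1| := abs_twistAt_apply_one _ _

/-- The endpoint of the piece has the parity of the endpoint of the bridge. [cite: EntingJensen2009, §7.4.2, Fig. 7.10 (brickwork form of the honeycomb lattice)] -/
theorem parity_pend (M : ℕ) (ω : ℕ → Site 2) : (pend M ω 0 + pend M ω 1) % 2 = (ω M 0 + ω M 1) % 2 :=
  parity_twistAt _ _

/-- The endpoint of the piece lies in the box `[-M, M]²`. [cite: MadrasSlade1993, §3.2 (proof of Theorem 3.2.4)] -/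
theorem pend_mem_box (hω : ω ∈ bridges M) : pend M ω ∈ box 2 M := by
  have h := Zd.apply_mem_box_of_mem_saws (piece_mem_zd hω)
  rwa [piece_apply_M hω] at h

/-- **The bridge is recovered from its piece and its re-rooting time** (the tree's `Zd.eq_of_reroot_eq`,
untwisted: the twist only depends on the parity of the root, which is that of `i`).
[cite: MadrasSlade1993, §3.2 (proof of Theorem 3.2.4)] -/
theorem eq_of_piece_eq {ξ : ℕ → Site 2} (hω : ω ∈ bridges M) (hξ : ξ ∈ bridges M) (ham : am M ω = am M ξ)
    (h : ∀ k ≤ M, piece M ω k = piece M ξ k) : ω = ξ := by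
  have hi := am_le M ω
  have hpar : (ω (am M ω) 0 + ω (am M ω) 1) % 2 = (ξ (am M ξ) 0 + ξ (am M ξ) 1) % 2 := by
    rw [parity_apply (mem_bridges.1 hω).1 hi, parity_apply (mem_bridges.1 hξ).1 (ham ▸ hi), ham]
  refine Zd.eq_of_reroot_eq (Zd.mem_bridges.1 (bridges_subset_zd M hω)).1
    (Zd.mem_bridges.1 (bridges_subset_zd M hξ)).1 hi fun k hk => ?_
  have hk' := h k hk
  simp only [piece] at hk'
  rw [twistAt_congr hpar, ← ham] at hk'
  exact twistAt_injective _ hk'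

end HexBW

end Literature.Probability.RandomPlanarGeometry.SAW
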